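import Summits.QuantumFields.BalabanUV.Beta.D1BFx.TorusWeightJetsCombFree
import Summits.QuantumFields.BalabanUV.Beta.D1BFx.GramWeightColourLift

/-!
# `BalabanUV.Beta.D1BFx.TorusWeightJetsTwisted` — road «BF-x» for binder row D1, slot (K), X₃(ii) ROUTE T, owner row **«TB4-W»** (K-ASSEMBLY-SPEC v2.5 §3 (T3),
# rulings ρ-g6-12 (1) ∕ ρ-g6-13 (1); FINDING F-g6-1 «colour lift»), PART 3a′ — **THE TWISTED (COLOUR-STRIPPED) WEIGHT JETS ARE COMB-FREE AND HAVE PURE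
# PARITY**: the weight slots of K-TA4C's STRIPPED identity `GramWeightColourLift.mixedVar_gramTransfer_stripped` (p241584) are the TWISTED Gram jets
# `b̃ₛ = tgram₁ T₀ tₛ A₀ Aₛ = −tₛᵀA₀T₀ + T₀ᵀAₛT₀ + T₀ᵀA₀tₛ`, `b̃ₛₜ = tgramMix …`; at PART 2's stripped co-frame ∕ inverse jets (`TorusCoframeJets.Tjet•∕Ajet•`,
# THE CONVENTION `ε = +1`) they equal `(2•twgt₁).submatrix e e`, `(2•twgtMix).submatrix e e` with the COMB-FREE site sandwiches
# `twgt₁ := −M̂ₛᵀĈM̂₀ + M̂₀ᵀĈₛM̂₀ + M̂₀ᵀĈM̂ₛ`, `twgtMix` (PART 3a's `Chat`∕`Cjet•`), and — unlike the untwisted `wgt₁` — **`twgt₁` is ANTISYMMETRIC and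
# `twgtMix` SYMMETRIC**: the stripped first weight jet is parity-ODD and the mixed one parity-EVEN, as the colour lift demands (`C ⊗ odd`, `C² ⊗ even`)

HONEST DEPENDENCY (cell records, verbatim): «continuum YM on T⁴ ⇐ BetaPertH ∧ nine spine estimates (0/9 proved); BetaPertH ⇐ (D1) ∧ (D4) ∧
CAP+tail; G-an2-4 gates asym, D1 and NE2/3/4.»  HONEST FRAMING (cell contract, verbatim): «discharging `BetaPertH` makes Bałaban's UV stability
UNCONDITIONAL — a real constructive-QFT result; it is NOT the continuum limit and NOT the Clay problem.»  THIS MODULE DISCHARGES NOTHING of (K),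
of D1 or of the wall: [our object] data definitions (explicit finite matrices, asserting nothing) and [folklore] finite matrix algebra over PART 3a
`TorusWeightJetsCombFree` (`Chat`, `Cjet₁`, `Cjet₁₁`, `Lsq•`, `sandwich_submatrix`, `basis_mul_Ajet•`), PART 2 `TorusCoframeJets` (`Mjet•`, `Tjet•`, `Ajet•`,
`transpose_Ljet`, `transpose_Ljet₁₁`, `transpose_Gjet₀`), gan24-leaf-03-g44's `GramWeightColourLift.tgram₁∕tgramMix` and the owner's `TorusGaugeWeight.Lhat_transpose`,
BY NAME.  No `def … : Prop`, nothing cited, no wall binder instantiated, 0 sorry.  0∕4 binders of row D1; (K) NOT closed; NOT D1, NOT BetaPertH, NOT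
continuum, NOT Clay.

ABSOLUTE RULE (cell charter, verbatim): «No internally-minted statement may enter as a cited fact. Every hypothesis is either kernel-proved in this
package or a verbatim quotation of a PUBLISHED theorem with page reference. The manuscript(s) under audit are NOT citable for their own disputed
steps — they are the thing under adjudication; programme-internal (2001/route/tribunal) claims are never citable.»

WHY (F-g6-1, K-TA4C).  The road's tables are COLOURLESS with parity types; stripped jets of SYMMETRIC operators along ONE colour direction are
antisymmetric at first order (`C ⊗ ·`, `Cᵀ = −C`) and symmetric at second order (`C² ⊗ ·`).  K-TA4G's plain product rule `gram₁` applied to stripped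
jets mixes parities (`wgt₁` of PART 3a is neither symmetric nor antisymmetric); the lift-consistent stripped weight jets are the TWISTED ones, which
THIS FILE makes comb-free and whose parities it certifies — a kernel-checked consistency test of THE CONVENTION of PARTS 1–2 (`(D*)₁ = −Ḋᵀ`, `(D*)₂ = +Ḋᵀ`,
transposed odd jets carry `−1`).  Under `ε ↦ −ε` (the sign dictionary of PART 1b) `twgt₁ ↦ −twgt₁`, `twgtMix ↦ twgtMix`.

CONTENT (`N : Matrix (Site 4 s) ρ ℝ`, `e : ν → Site 4 s × Fin 4`; `Ĉ := Chat s N`, `M̂• := Mjet•`):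
* §1 [our object] `twgt₁ s b N := −M̂ₛᵀĈM̂₀ + M̂₀ᵀĈₛM̂₀ + M̂₀ᵀĈM̂ₛ`, `twgtMix s b b′ N` (nine terms, `−` exactly on the terms with ONE transposed odd jet);
  [folklore] **`tgram₁_Tjet : tgram₁ (Tjet₀ s N e) (Tjet₁ s b N e) (Ajet₀ s N) (Ajet₁ s b N) = ((2:ℝ) • twgt₁ s b N).submatrix e e`**, **`tgramMix_Tjet`**.
* §2 [folklore] parities: `transpose_Chat` (`Ĉᵀ = Ĉ`), `transpose_Lsq₁` (odd), `transpose_Lsq₁₁` (even), `transpose_Cjet₁` (odd), `transpose_Cjet₁₁` (even),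
  `transpose_Mjet•`-free proofs of **`transpose_twgt₁ : (twgt₁)ᵀ = −twgt₁`** and **`transpose_twgtMix : (twgtMix)ᵀ = twgtMix`**; hence
  `transpose_tgram₁_Tjet` (the stripped first weight slot is antisymmetric) and `transpose_tgramMix_Tjet` (the mixed one symmetric) for every `N`, `e`.
NOT HERE: the `ℤ⁴` arrays (PART 3b), TB4-tables (T1), (T2-kin), TB5.
Provenance: D1 formalisation swarm, unit `b2b-balaban-beta-d1-formalise-leaf-03` (gen 9), claim «TB4-W» journal l.23490 ∕ plan l.24110, 2026-08-21.
-/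

noncomputable section

namespace Summit.QuantumFields.BalabanUV.Beta.D1BFx.TorusWeightJetsTwisted

open Matrix
open scoped BigOperators
open Literature.MathematicalPhysics.QuantumFieldTheory.Balaban1983to89
open Literature.MathematicalPhysics.QuantumFieldTheory.Balaban1983to89.Beta
open Summit.QuantumFields.BalabanUV.Beta.D1BFx.PeriodisedProjector (Lhat)
open Summit.QuantumFields.BalabanUV.Beta.D1BFx.TorusGaugeWeight (Lhat_transpose)
open Summit.QuantumFields.BalabanUV.Beta.D1BFx.TorusHodgeWeight (Dhat)
open Summit.QuantumFields.BalabanUV.Beta.D1BFx.GramWeightColourLift (tgram₁ tgramMix)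
open Summit.QuantumFields.BalabanUV.Beta.D1BFx.TorusCoframeJets (Djet Ljet Ljet₁₁ Mjet₀ Mjet₁ Mjet₁₁ Tjet₀ Tjet₁ Tjet₁₁ Gjet₀ Ajet₀ Ajet₁ Ajet₁₁
  transpose_Ljet transpose_Ljet₁₁ transpose_Gjet₀)
open Summit.QuantumFields.BalabanUV.Beta.D1BFx.TorusWeightJetsCombFree (Lsq₁ Lsq₁₁ Chat Cjet₁ Cjet₁₁ sandwich_submatrix basis_mul_Ajet₀
  basis_mul_Ajet₁ basis_mul_Ajet₁₁)

variable (s : ℕ) [NeZero s] (b b' : Site 4 s × Fin 4)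

section Basis

variable {ρ ν : Type*} [Fintype ρ] [DecidableEq ρ] (N : Matrix (Site 4 s) ρ ℝ) (e : ν → Site 4 s × Fin 4)

/-! ## §1 The twisted comb-free weight jets and the twisted Gram identities -/

/-- [our object] **`twgt₁ := −M̂ₛᵀĈM̂₀ + M̂₀ᵀĈₛM̂₀ + M̂₀ᵀĈM̂ₛ`** (half the TWISTED first weight jet `b̃ₛ`).  A definition. -/
def twgt₁ : Matrix (Site 4 s × Fin 4) (Site 4 s × Fin 4) ℝ :=
  -((Mjet₁ s b)ᵀ * Chat s N * Mjet₀ s) + (Mjet₀ s)ᵀ * Cjet₁ s b N * Mjet₀ s + (Mjet₀ s)ᵀ * Chat s N * Mjet₁ s b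

/-- [our object] **`twgtMix`** := the nine-term TWISTED mixed jet of `M̂ᵀĈM̂` (signs `−` exactly on the terms with one transposed odd jet; half of `b̃ₛₜ`).
A definition. -/
def twgtMix : Matrix (Site 4 s × Fin 4) (Site 4 s × Fin 4) ℝ :=
  (Mjet₁₁ s b b')ᵀ * Chat s N * Mjet₀ s + -((Mjet₁ s b)ᵀ * Cjet₁ s b' N * Mjet₀ s) + -((Mjet₁ s b')ᵀ * Cjet₁ s b N * Mjet₀ s)
    + (Mjet₀ s)ᵀ * Cjet₁₁ s b b' N * Mjet₀ s + -((Mjet₁ s b)ᵀ * Chat s N * Mjet₁ s b') + -((Mjet₁ s b')ᵀ * Chat s N * Mjet₁ s b)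
    + (Mjet₀ s)ᵀ * Cjet₁ s b N * Mjet₁ s b' + (Mjet₀ s)ᵀ * Cjet₁ s b' N * Mjet₁ s b + (Mjet₀ s)ᵀ * Chat s N * Mjet₁₁ s b b'

/-- [folklore] **`b̃ₛ` COMB-FREE**: `tgram₁ T₀ Tₛ A₀ Aₛ = (2•twgt₁).submatrix e e` at PART 2's stripped jets. -/
theorem tgram₁_Tjet : tgram₁ (Tjet₀ s N e) (Tjet₁ s b N e) (Ajet₀ s N) (Ajet₁ s b N) = ((2 : ℝ) • twgt₁ s b N).submatrix e e := by
  rw [tgram₁, Tjet₀, Tjet₁, sandwich_submatrix, sandwich_submatrix, sandwich_submatrix, basis_mul_Ajet₀, basis_mul_Ajet₁, twgt₁,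
    smul_add, smul_add, smul_neg, Matrix.submatrix_add, Matrix.submatrix_add, Pi.add_apply, Pi.add_apply, Pi.add_apply, Pi.add_apply,
    Matrix.submatrix_neg, Pi.neg_apply, Pi.neg_apply]
  simp only [Matrix.mul_smul, Matrix.smul_mul]

/-- [folklore] **`b̃ₛₜ` COMB-FREE**: `tgramMix T₀ Tₛ Tₜ Tₛₜ A₀ Aₛ Aₜ Aₛₜ = (2•twgtMix).submatrix e e` at PART 2's stripped jets. -/
theorem tgramMix_Tjet : tgramMix (Tjet₀ s N e) (Tjet₁ s b N e) (Tjet₁ s b' N e) (Tjet₁₁ s b b' N e)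
      (Ajet₀ s N) (Ajet₁ s b N) (Ajet₁ s b' N) (Ajet₁₁ s b b' N) = ((2 : ℝ) • twgtMix s b b' N).submatrix e e := by
  rw [tgramMix, Tjet₀, Tjet₁, Tjet₁, Tjet₁₁]
  simp only [sandwich_submatrix, basis_mul_Ajet₀, basis_mul_Ajet₁, basis_mul_Ajet₁₁]
  rw [twgtMix]
  simp only [smul_add, smul_neg, Matrix.submatrix_add, Matrix.submatrix_neg, Pi.add_apply, Pi.neg_apply, Matrix.mul_smul, Matrix.smul_mul]

/-! ## §2 Parities: `twgt₁` is ODD, `twgtMix` is EVEN -/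

/-- [folklore] `Ĉᵀ = Ĉ`. -/
theorem transpose_Chat : (Chat s N)ᵀ = Chat s N := by
  rw [Chat, Matrix.transpose_mul, Matrix.transpose_mul, Matrix.transpose_transpose, Matrix.transpose_nonsing_inv, transpose_Gjet₀, Matrix.mul_assoc]

omit [Fintype ρ] [DecidableEq ρ] in
/-- [folklore] `(L̂²)ₛᵀ = −(L̂²)ₛ` (odd). -/
theorem transpose_Lsq₁ : (Lsq₁ s b)ᵀ = -Lsq₁ s b := by
  rw [Lsq₁, Matrix.transpose_add, Matrix.transpose_mul, Matrix.transpose_mul, transpose_Ljet, Lhat_transpose, Matrix.mul_neg, Matrix.neg_mul,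
    neg_add, add_comm]

omit [Fintype ρ] [DecidableEq ρ] in
/-- [folklore] `(L̂²)ₛₜᵀ = (L̂²)ₛₜ` (even). -/
theorem transpose_Lsq₁₁ : (Lsq₁₁ s b b')ᵀ = Lsq₁₁ s b b' := by
  rw [Lsq₁₁, Matrix.transpose_add, Matrix.transpose_add, Matrix.transpose_add, Matrix.transpose_mul, Matrix.transpose_mul, Matrix.transpose_mul,
    Matrix.transpose_mul, transpose_Ljet, transpose_Ljet, transpose_Ljet₁₁, Lhat_transpose, neg_mul_neg, neg_mul_neg]
  abel

/-- [folklore] `Ĉₛᵀ = −Ĉₛ` (odd). -/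
theorem transpose_Cjet₁ : (Cjet₁ s b N)ᵀ = -Cjet₁ s b N := by
  have hC := transpose_Chat s N
  have h1 := transpose_Lsq₁ s b
  rw [Cjet₁, Matrix.transpose_neg]
  simp only [Matrix.transpose_mul, hC, h1, Matrix.mul_neg, Matrix.neg_mul, neg_neg, Matrix.mul_assoc]

/-- [folklore] `Ĉₛₜᵀ = Ĉₛₜ` (even). -/
theorem transpose_Cjet₁₁ : (Cjet₁₁ s b b' N)ᵀ = Cjet₁₁ s b b' N := by
  have hC := transpose_Chat s N
  have h1 := transpose_Lsq₁ s b
  have h1' := transpose_Lsq₁ s b'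
  have h11 := transpose_Lsq₁₁ s b b'
  rw [Cjet₁₁, Matrix.transpose_add, Matrix.transpose_add, Matrix.transpose_neg]
  simp only [Matrix.transpose_mul, hC, h1, h1', h11, Matrix.mul_neg, Matrix.neg_mul, neg_neg, Matrix.mul_assoc]
  abel

/-- [folklore] **THE STRIPPED FIRST WEIGHT JET IS ODD**: `(twgt₁)ᵀ = −twgt₁`. -/
theorem transpose_twgt₁ : (twgt₁ s b N)ᵀ = -twgt₁ s b N := by
  have hC := transpose_Chat s N
  have h1 := transpose_Cjet₁ s b N
  rw [twgt₁, Matrix.transpose_add, Matrix.transpose_add, Matrix.transpose_neg]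
  simp only [Matrix.transpose_mul, Matrix.transpose_transpose, hC, h1, Matrix.mul_neg, Matrix.neg_mul, Matrix.mul_assoc]
  abel

/-- [folklore] **THE STRIPPED MIXED WEIGHT JET IS EVEN**: `(twgtMix)ᵀ = twgtMix`. -/
theorem transpose_twgtMix : (twgtMix s b b' N)ᵀ = twgtMix s b b' N := by
  have hC := transpose_Chat s N
  have h1 := transpose_Cjet₁ s b N
  have h1' := transpose_Cjet₁ s b' N
  have h11 := transpose_Cjet₁₁ s b b' N
  rw [twgtMix]
  simp only [Matrix.transpose_add, Matrix.transpose_neg, Matrix.transpose_mul, Matrix.transpose_transpose, hC, h1, h1', h11, Matrix.mul_neg,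
    Matrix.neg_mul, neg_neg, Matrix.mul_assoc]
  abel

/-- [folklore] Hence the stripped first weight slot of K-TA4C is antisymmetric at PART 2's jets, for every `N` and every re-indexing `e`. -/
theorem transpose_tgram₁_Tjet : (tgram₁ (Tjet₀ s N e) (Tjet₁ s b N e) (Ajet₀ s N) (Ajet₁ s b N))ᵀ
    = -tgram₁ (Tjet₀ s N e) (Tjet₁ s b N e) (Ajet₀ s N) (Ajet₁ s b N) := by
  rw [tgram₁_Tjet, Matrix.transpose_submatrix, Matrix.transpose_smul, transpose_twgt₁, smul_neg, Matrix.submatrix_neg, Pi.neg_apply, Pi.neg_apply]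

/-- [folklore] … and the stripped mixed weight slot is symmetric. -/
theorem transpose_tgramMix_Tjet : (tgramMix (Tjet₀ s N e) (Tjet₁ s b N e) (Tjet₁ s b' N e) (Tjet₁₁ s b b' N e)
      (Ajet₀ s N) (Ajet₁ s b N) (Ajet₁ s b' N) (Ajet₁₁ s b b' N))ᵀ
    = tgramMix (Tjet₀ s N e) (Tjet₁ s b N e) (Tjet₁ s b' N e) (Tjet₁₁ s b b' N e) (Ajet₀ s N) (Ajet₁ s b N) (Ajet₁ s b' N) (Ajet₁₁ s b b' N) := by
  rw [tgramMix_Tjet, Matrix.transpose_submatrix, Matrix.transpose_smul, transpose_twgtMix]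

end Basis

end Summit.QuantumFields.BalabanUV.Beta.D1BFx.TorusWeightJetsTwisted

end
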